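import Literature.AlgebraicTopology.CharacteristicClasses.LineCocycleChernClass
import Literature.AlgebraicTopology.CharacteristicClasses.TautologicalEulerClass
import Literature.AlgebraicTopology.CharacteristicClasses.TautologicalLineCore
import HarnessLib

/-!
# Euler classes `e(g)(m) ∈ H²(B; R)` of a continuous line cocycle, all coefficients; the tautological cocycle of `ℙ(V)`

Topic `Literature/AlgebraicTopology/CharacteristicClasses`, namespace `Literature.AlgebraicTopology.CharacteristicClasses`.
THEOREMS ONLY (no definition, no named fact, no instance).  Companion of ★ `LineCocycleChernClass` (the INTEGRAL first Chern
class `lineChernClass Z ∈ H²(B; ℤ)` of a line cocycle `Z : VectorBundleCore ℂ B ℂ ι`): the same invariances for the Euler class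
`eulerClass ℂ Z.Fiber _ R m ∈ H²(B; R)` of the glued bundle with ARBITRARY coefficients `R` and generator `m : R` (★ `LineEulerClass`:
the Euler class `s₀^* t(m)` of the Thom class; for `R = ℤ`, `m = 1` this is `c₁`, for `R = ℂ` it is the class the Hodge-theoretic
consumers use on the real carrier `H²(–; ℂ)` without a change of coefficients):

* `coreEulerClass_pullbackCore` — `e(f^*g) = f^* e(g)` (Husemoller Ch. 5 Prop. 3.3 / Ch. 17 Prop. 3.3; ★ `eulerClass_pullback` +
  ★ `eulerClass_iso` along the morphism of cores ★ `continuous_pullbackCore_map`);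
* `coreEulerClass_eq_of_cohomologous` / `_of_coboundary` / `_of_refinement` — cohomologous cocycles (refinement `j`, continuous
  non-vanishing `h_i`, `g′_{j i, j i′} h_i = h_{i′} g_{i i′}`) have the same Euler classes (★ `continuous_cohomologousFiber` +
  ★ `eulerClass_iso`);
* **`tautEuler_eq_coreEulerClass_tautologicalLineCore`** — for a finite-dimensional `V`, the Euler class ★ `tautEuler V R m` of the
  tautological line bundle `γ¹(V) → ℙ(V)` with the lines as fibres (★ `ProjectiveTautologicalBundle`) IS the Euler class of the
  tautological COCYCLE ★ `tautologicalLineCore ℂ V` (`{([v], u) | u ∈ ℂ v}` presented by `ψ v/φ v` on the functional charts) — «same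
  charts and cocycle» (the comparison announced and not made in ★ `TautologicalLineCore`): the fibrewise isomorphisms
  `w ↦ φ_ℓ(w)` (`φ_ℓ` the distinguished functional of the cocycle at `ℓ`) have the continuous local expression
  `(ℓ, x) ↦ x · φ_{ℓ₀}(v_{χ₀}(ℓ))` (Hirzebruch §4.2);
* (so that ★ `Motives.SegreHyperplaneClass.tautEuler_ne_zero` — `e(γ¹(ℂ^{N+1}))(1) ≠ 0` in `H²(ℙ(ℂ^{N+1}); ℂ)`, `N ≥ 1`,
  Milnor–Stasheff Thm. 14.4 — transfers to the cocycle).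

Cell pointer: `hodgecm-mathlib` (U)-lane, leaf (T2½) «top ↔ Chern–Weil line bridge», file (A); HC_CM is proved only modulo the 7
printed citations until rung 0 closes, and this file discharges none of them.

## References
* [HusemollerFibreBundles1994] D. Husemoller, *Fibre Bundles*, 3rd ed. (1994), Ch. 5 §3 (Thm. 3.2, Prop. 3.3, Prop. 3.5), Ch. 17 §2
  Thm. 2.3 and §3 Prop. 3.3.
* [Hirzebruch1966] F. Hirzebruch, *Topological Methods in Algebraic Geometry*, 3rd ed. (1966), §3.2, §4.2.
* [MilnorStasheff1974] J. Milnor, J. Stasheff, *Characteristic Classes* (1974), §14 (p. 158, Thm. 14.4).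
-/

set_option autoImplicit false

noncomputable section

open Bundle Set Filter Topology Function
open Literature.AlgebraicTopology.SingularHomology
open scoped LinearAlgebra.Projectivization

namespace Literature.AlgebraicTopology.CharacteristicClasses

/-! ### Naturality: `e(f^*g) = f^* e(g)` -/

section Pullback

variable {B B' : Type} [TopologicalSpace B] [TopologicalSpace B'] {ι : Type*}
  (Z : VectorBundleCore ℂ B ℂ ι) (f : C(B', B)) (R : Type) [CommRing R]
  [T2Space B] [ParacompactSpace B] [T2Space B'] [ParacompactSpace B']

/-- **`e(f^*g)(m) = f^* e(g)(m)`** for the induced cocycle, any coefficients (Husemoller Ch. 17 Prop. 3.3): the bundle of `f^*g` is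
isomorphic to the pull-back bundle `f *ᵖ` (★ `continuous_pullbackCore_map`), ★ `eulerClass_iso`, ★ `eulerClass_pullback`.
[cite: HusemollerFibreBundles1994, Ch. 17 Prop. 3.3] [cite: HusemollerFibreBundles1994, Ch. 5 §3 Prop. 3.3] -/
theorem coreEulerClass_pullbackCore (m : R) :
    eulerClass ℂ (Z.pullbackCore f).Fiber (Module.finrank_self ℂ) R m =
      singularCohomology.map R R f 2 (eulerClass ℂ Z.Fiber (Module.finrank_self ℂ) R m) := by
  have hbase : ∀ i, (Z.pullbackCore f).baseSet i ⊆ f ⁻¹' Z.baseSet (id i) := fun _ _ hb ↦ hb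
  have hcont : Continuous fun q : (Z.pullbackCore f).TotalSpace ↦
      (⟨(ContinuousMap.id B') q.proj, (Z.pullbackCore f).morphEquiv (Z₂ := Z) (f := f) (j := id) hbase q.proj q.2⟩ :
        TotalSpace ℂ (⇑f *ᵖ Z.Fiber)) := by
    rw [(inducing_pullbackTotalSpaceEmbedding ℂ Z.Fiber ⇑f).continuous_iff]
    exact (FiberBundle.continuous_proj ℂ _).prodMk (continuous_pullbackCore_map Z f)
  rw [eulerClass_iso ℂ (Z.pullbackCore f).Fiber (Module.finrank_self ℂ) R ℂ (⇑f *ᵖ Z.Fiber) (Module.finrank_self ℂ)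
    (fun b ↦ (Z.pullbackCore f).morphEquiv (Z₂ := Z) (f := f) (j := id) hbase b) hcont m, eulerClass_pullback]

end Pullback

/-! ### Cohomologous cocycles -/

section Cohomologous

variable {B : Type} [TopologicalSpace B] {ι₁ ι₂ : Type*}
  {Z₁ : VectorBundleCore ℂ B ℂ ι₁} {Z₂ : VectorBundleCore ℂ B ℂ ι₂} {j : ι₁ → ι₂} {h : ι₁ → B → ℂ}
  (R : Type) [CommRing R] [T2Space B] [ParacompactSpace B]

/-- **Cohomologous line cocycles have the same Euler classes, any coefficients** (Husemoller Ch. 5 Thm. 3.2 / Prop. 3.5: refinement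
`j`, units `h_i` with `g′_{j i, j i′} h_i = h_{i′} g_{i i′}` ⇒ isomorphic bundles; ★ `continuous_cohomologousFiber`, ★ `eulerClass_iso`).
[cite: HusemollerFibreBundles1994, Ch. 5 §3 Thm. 3.2] [cite: Hirzebruch1966, §3.2] -/
theorem coreEulerClass_eq_of_cohomologous (hbase : ∀ i, Z₁.baseSet i ⊆ Z₂.baseSet (j i))
    (hc : ∀ i, ContinuousOn (h i) (Z₁.baseSet i)) (h0 : ∀ i b, b ∈ Z₁.baseSet i → h i b ≠ 0)
    (hcob : ∀ i i' b, b ∈ Z₁.baseSet i ∩ Z₁.baseSet i' →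
      Z₂.coordChange (j i) (j i') b 1 * h i b = h i' b * Z₁.coordChange i i' b 1) (m : R) :
    eulerClass ℂ Z₁.Fiber (Module.finrank_self ℂ) R m = eulerClass ℂ Z₂.Fiber (Module.finrank_self ℂ) R m := by
  have hcont : Continuous fun q : Z₁.TotalSpace ↦
      (⟨(ContinuousMap.id B) q.proj, cohomologousEquiv hbase h0 q.proj q.2⟩ : Z₂.TotalSpace) :=
    (continuous_cohomologousFiber hbase hc hcob).congr fun _ ↦ rfl
  exact eulerClass_iso ℂ Z₁.Fiber (Module.finrank_self ℂ) R ℂ Z₂.Fiber (Module.finrank_self ℂ)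
    (fun b ↦ cohomologousEquiv hbase h0 b) hcont m

/-- **Coboundary invariance** (same cover), any coefficients. [cite: HusemollerFibreBundles1994, Ch. 5 §3 Thm. 3.2] -/
theorem coreEulerClass_eq_of_coboundary {ι : Type*} (Z Z' : VectorBundleCore ℂ B ℂ ι) (hU : ∀ i, Z.baseSet i ⊆ Z'.baseSet i)
    (h : ι → B → ℂ) (hc : ∀ i, ContinuousOn (h i) (Z.baseSet i)) (h0 : ∀ i b, b ∈ Z.baseSet i → h i b ≠ 0)
    (hcob : ∀ i i' b, b ∈ Z.baseSet i ∩ Z.baseSet i' → Z'.coordChange i i' b 1 * h i b = h i' b * Z.coordChange i i' b 1)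
    (m : R) : eulerClass ℂ Z.Fiber (Module.finrank_self ℂ) R m = eulerClass ℂ Z'.Fiber (Module.finrank_self ℂ) R m :=
  coreEulerClass_eq_of_cohomologous (j := id) R hU hc h0 hcob m

/-- **Refinement invariance**, any coefficients. [cite: Hirzebruch1966, §3.2] [cite: HusemollerFibreBundles1994, Ch. 5 §3 Thm. 3.2] -/
theorem coreEulerClass_eq_of_refinement (hbase : ∀ i, Z₁.baseSet i ⊆ Z₂.baseSet (j i))
    (hres : ∀ i i' b, b ∈ Z₁.baseSet i ∩ Z₁.baseSet i' → Z₁.coordChange i i' b 1 = Z₂.coordChange (j i) (j i') b 1) (m : R) :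
    eulerClass ℂ Z₁.Fiber (Module.finrank_self ℂ) R m = eulerClass ℂ Z₂.Fiber (Module.finrank_self ℂ) R m :=
  coreEulerClass_eq_of_cohomologous (h := fun _ _ ↦ 1) R hbase (fun _ ↦ continuousOn_const) (fun _ _ _ ↦ one_ne_zero)
    (fun i i' b hb ↦ by rw [mul_one, one_mul, hres i i' b hb]) m

end Cohomologous

/-! ### The tautological cocycle of `ℙ(V)` and the tautological line bundle with the lines as fibres -/

section Tautological

variable (V : Type) [NormedAddCommGroup V] [NormedSpace ℂ V] [FiniteDimensional ℂ V]

omit [FiniteDimensional ℂ V] in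
/-- The cocycle identity of normalised representatives: `ψ₀(v_ψ(ℓ)) · ψ(v_χ(ℓ)) = ψ₀(v_χ(ℓ))` for `ℓ ∈ U_ψ ∩ U_χ`
(`v_φ(ℓ) = (φ v)⁻¹ v`). [cite: Hirzebruch1966, §4.2] -/
theorem apply_affineRep_mul_apply_affineRep (ψ₀ ψ χ : StrongDual ℂ V) {ℓ : ℙ ℂ V}
    (hψ : ℓ ∈ chartDomain (ψ : Module.Dual ℂ V)) (hχ : ℓ ∈ chartDomain (χ : Module.Dual ℂ V)) :
    ψ₀ (affineRep (ψ : Module.Dual ℂ V) ℓ) * ψ (affineRep (χ : Module.Dual ℂ V) ℓ) = ψ₀ (affineRep (χ : Module.Dual ℂ V) ℓ) := by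
  induction ℓ using Projectivization.ind with
  | h v hv =>
    have hψv : ψ v ≠ 0 := (mk_mem_chartDomain_iff _ v hv).1 hψ
    have hχv : χ v ≠ 0 := (mk_mem_chartDomain_iff _ v hv).1 hχ
    rw [apply_affineRep_mk, apply_affineRep_mk, apply_affineRep_mk]
    field_simp

/-- **The fibrewise isomorphisms `ℓ ∋ w ↦ φ_ℓ(w) ∈ ℂ`** (`φ_ℓ` the distinguished functional of the tautological cocycle at `ℓ`,
★ `fiberEquivOfMemChart`) **form a continuous map of total spaces `γ¹(V) → E(tautologicalLineCore)`**: in the trivialisations at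
`ℓ₀` (functional `χ₀` for `γ¹(V)`, `φ_{ℓ₀}` for the cocycle) the map reads `(ℓ, x) ↦ x · φ_{ℓ₀}(v_{χ₀}(ℓ))`, continuous near `ℓ₀`
(★ `continuousOn_affineRep`). [cite: Hirzebruch1966, §4.2] [cite: HusemollerFibreBundles1994, Ch. 5 §3 Thm. 3.2] -/
theorem continuous_tautFiber_to_tautologicalLineCore :
    Continuous fun q : TotalSpace ℂ (tautFiber ℂ V) ↦
      (⟨(ContinuousMap.id (ℙ ℂ V)) q.proj,
        fiberEquivOfMemChart ((tautologicalLineCore ℂ V).indexAt q.proj) ((tautologicalLineCore ℂ V).mem_baseSet_at q.proj) q.2⟩ :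
        (tautologicalLineCore ℂ V).TotalSpace) := by
  set Z := tautologicalLineCore ℂ V with hZ
  refine continuous_totalSpace_map (F₁ := ℂ) (F₂ := ℂ) (E₁ := tautFiber ℂ V) (E₂ := Z.Fiber) continuous_id
    (fun ℓ w ↦ fiberEquivOfMemChart (Z.indexAt ℓ) (Z.mem_baseSet_at ℓ) w) fun p ↦ ?_
  obtain ⟨ℓ₀, w₀⟩ := p
  -- the two charts at `ℓ₀`
  set χ₀ : StrongDual ℂ V := chartFunctional ℂ V ℓ₀ with hχ₀
  set ψ₀ : StrongDual ℂ V := Z.indexAt ℓ₀ with hψ₀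
  have hℓ₀χ : ℓ₀ ∈ chartDomain (χ₀ : Module.Dual ℂ V) := mem_chartDomain_chartFunctional ℂ V ℓ₀
  -- the local expression `(ℓ, x) ↦ x · ψ₀(v_{χ₀}(ℓ))` is continuous at the image point
  have hA : ContinuousAt (fun ℓ : ℙ ℂ V ↦ ψ₀ (affineRep (χ₀ : Module.Dual ℂ V) ℓ)) ℓ₀ :=
    ((ψ₀.continuous.comp_continuousOn (continuousOn_affineRep _ χ₀.continuous)).continuousAt
      ((isOpen_chartDomain _ χ₀.continuous).mem_nhds hℓ₀χ))
  have hpt : trivializationAt ℂ (tautFiber ℂ V) ℓ₀ ⟨ℓ₀, w₀⟩ = (ℓ₀, χ₀ (w₀ : V)) := rfl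
  rw [hpt]
  have hloc : ContinuousAt (fun q : ℙ ℂ V × ℂ ↦ q.2 * ψ₀ (affineRep (χ₀ : Module.Dual ℂ V) q.1)) (ℓ₀, χ₀ (w₀ : V)) :=
    continuousAt_snd.mul (hA.comp_of_eq continuousAt_fst rfl)
  refine hloc.congr_of_eventuallyEq ?_
  have hN : ∀ᶠ q : ℙ ℂ V × ℂ in 𝓝 (ℓ₀, χ₀ (w₀ : V)), q.1 ∈ chartDomain (χ₀ : Module.Dual ℂ V) :=
    continuousAt_fst.preimage_mem_nhds ((isOpen_chartDomain _ χ₀.continuous).mem_nhds hℓ₀χ)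
  filter_upwards [hN] with q hq
  have hqψ : q.1 ∈ chartDomain ((Z.indexAt q.1 : StrongDual ℂ V) : Module.Dual ℂ V) := Z.mem_baseSet_at q.1
  change (Z.localTriv (Z.indexAt ℓ₀) ⟨q.1, fiberEquivOfMemChart (Z.indexAt q.1) (Z.mem_baseSet_at q.1)
      ((trivializationAt ℂ (tautFiber ℂ V) ℓ₀).toPartialEquiv.symm q).2⟩).2 = q.2 * ψ₀ (affineRep (χ₀ : Module.Dual ℂ V) q.1)
  rw [VectorBundleCore.localTriv_apply]
  change (ψ₀ (affineRep ((Z.indexAt q.1 : StrongDual ℂ V) : Module.Dual ℂ V) q.1) • ContinuousLinearMap.id ℂ ℂ)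
      ((Z.indexAt q.1) (q.2 • affineRep (χ₀ : Module.Dual ℂ V) q.1)) = _
  rw [FunLike.coe_smul, Pi.smul_apply, ContinuousLinearMap.id_apply, map_smul, smul_eq_mul, smul_eq_mul, mul_left_comm,
    apply_affineRep_mul_apply_affineRep V ψ₀ (Z.indexAt q.1) χ₀ hqψ hq]

variable (R : Type) [CommRing R]

/-- **`e(γ¹(V))(m) = e(tautologicalLineCore ℂ V)(m)`** — the Euler class of the tautological line bundle with the lines as fibres
(★ `tautEuler`) is the Euler class of the tautological cocycle, for all coefficients (★ `eulerClass_iso` along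
`continuous_tautFiber_to_tautologicalLineCore`). [cite: HusemollerFibreBundles1994, Ch. 17 §2 Thm. 2.3] [cite: Hirzebruch1966, §4.2] -/
theorem tautEuler_eq_coreEulerClass_tautologicalLineCore (m : R) :
    tautEuler V R m = eulerClass ℂ (tautologicalLineCore ℂ V).Fiber (Module.finrank_self ℂ) R m :=
  eulerClass_iso ℂ (tautFiber ℂ V) (Module.finrank_self ℂ) R ℂ (tautologicalLineCore ℂ V).Fiber (Module.finrank_self ℂ)
    (fun ℓ ↦ fiberEquivOfMemChart ((tautologicalLineCore ℂ V).indexAt ℓ) ((tautologicalLineCore ℂ V).mem_baseSet_at ℓ))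
    (continuous_tautFiber_to_tautologicalLineCore V) m

end Tautological

end Literature.AlgebraicTopology.CharacteristicClasses

end
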